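import Summits.Ventures.LatticeQCDFlow.Exactness.FreeFieldFlowTauIntVolumeLaw
import Summits.Ventures.LatticeQCDFlow.Exactness.IMHSignObservableSandwich
import Summits.Ventures.LatticeQCDFlow.Scoring.FreeFieldHMCAutocorrelation
import HarnessLib

/-!
# The volume FLOOR of `τ_int` for the free-field flow arm: `τ_int(sign) ≥ e^{½ Σ_k (1 − a_k/b_k)²} − ½`

HONEST FRAMING: exact (Metropolis-corrected) sampling algorithms for lattice gauge theory;
figures of merit are autocorrelation/cost numbers at stated couplings and volumes; no
continuum-physics claim.  (SCALAR calibration rung S0-A: not a gauge result.)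

Venture `LatticeQCDFlow` (cell pub-lqcd), topic `Exactness`; FANOUT row 2 (`s0-phi4`, FLOW arm, the
free-field limit of the exactness battery).  NEW WORK of the cell: the matching LOWER bound that
`FreeFieldFlowTauIntVolumeLaw` listed as NOT CLAIMED.  Its ceiling was
`τ_int(g) ≤ ½ + 12 (B²/E[g²]) e^{½ Σ_k (r_k − 1)²/(2r_k − 1)}`; the floor below comes from the sign
sandwich `1/κ − ½ ≤ τ_int` of `IMHSignObservableSandwich` (`κ` the Kish ESS fraction of the weights),
row 2's product weight moment `1/κ = Π_k b_k/√(a_k(2b_k − a_k))` (`gaussProd_weightMoment`) and the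
elementary `1/√(1 − x) ≥ e^{x/2}`.  Nothing is cited as a fact.

## What is proved (modes `k : ι`, `ι` finite; target `p = ⊗_k N(0, a_k)`, model `q = ⊗_k N(0, b_k)` on
`ℝ^ι`, `a_k, b_k > 0`, `a_k < 2b_k`; `r_k = b_k/a_k`; a SIGN observable is a measurable `g` with
`g² = 1` and `∫ g p = 0`)

* `exp_half_le_one_div_sqrt` — `e^{x/2} ≤ 1/√(1 − x)` for `x < 1`; `gaussMode_invESS_ge_exp` —
  `b/√(a(2b − a)) ≥ e^{½(1 − a/b)²}`; `prod_invESS_ge_exp` —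
  `Π_k b_k/√(a_k(2b_k − a_k)) ≥ exp(½ Σ_k (1 − a_k/b_k)²)`;
* **`freeFieldFlow_sign_tauInt_ge_prod`** — along the exact independence sampler, for every sign
  observable: `τ_int(g) ≥ Π_k b_k/√(a_k(2b_k − a_k)) − ½ = 1/κ − ½`;
  **`freeFieldFlow_sign_tauInt_ge_exp`** — THE VOLUME FLOOR: `τ_int(g) ≥ exp(½ Σ_k (1 − a_k/b_k)²) − ½`;
* `integral_halfLineSign_mul_gaussian` — `∫ sgn₊(t) N(0,v)(t) dt = 0` (`sgn₊ = 1` on `t ≥ 0`, `−1`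
  else; reflection invariance of Lebesgue measure, `{0}` null); `integral_coordSign_mul_gaussProd` —
  the sign of any one coordinate IS a sign observable of the product target (Fubini);
  **`freeFieldFlow_coordSign_tauInt_ge_exp`** — hence, with NO hypothesis on `g` left: the sign of
  mode `k₀` decorrelates no faster than `exp(½ Σ_k (1 − a_k/b_k)²) − ½` steps of the exact flow
  sampler.

Reading for S0-A (no numerics implied): together with `FreeFieldFlowTauIntVolumeLaw` this is the
TWO-SIDED volume law of the flow arm on the free field,
`e^{½ Σ_k (1 − 1/r_k)²} − ½ ≤ τ_int(sign of a mode) ≤ ½ + 12 e^{½ Σ_k (r_k − 1)²/(2r_k − 1)}`: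
a flow that models each of `V` modes to a FIXED relative variance accuracy `ε` drives an exact chain
whose sign observables need at least `≈ e^{Vε²/2}` steps per independent value — exponential slowing
down in the volume unless `ε ∝ V^{−1/2}` (barrier B1, `τ_int` face, floor side).  NOT CLAIMED: `λ > 0`;
correlated-mode models; smooth observables (their floor is the quadratic log-weight bound of
`FlowSamplerLogWeightCSD`); any number for a trained network.
-/

namespace Summit.Ventures.LatticeQCDFlow.Exactness

open Real MeasureTheory Filter Set Topology ProbabilityTheory
open Summit.Ventures.LatticeQCDFlow.Scoring

/-! ## §1 The inverse ESS of a mis-sized Gaussian mode is at least `e^{½(1 − a/b)²}` -/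

/-- `e^{x/2} ≤ 1/√(1 − x)` for `x < 1` (`1 − x ≤ e^{−x}`, square roots). -/
theorem exp_half_le_one_div_sqrt {x : ℝ} (hx : x < 1) :
    Real.exp (x / 2) ≤ 1 / Real.sqrt (1 - x) := by
  have h1 : 0 < 1 - x := by linarith
  have hs : 0 < Real.sqrt (1 - x) := Real.sqrt_pos.mpr h1
  rw [le_div_iff₀ hs, ← Real.sqrt_sq (Real.exp_pos (x / 2)).le, ← Real.sqrt_mul (sq_nonneg _)]
  have e : Real.exp (x / 2) ^ 2 = Real.exp x := by rw [← Real.exp_nat_mul]; ring_nf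
  rw [e]
  calc Real.sqrt (Real.exp x * (1 - x)) ≤ Real.sqrt 1 := by
        refine Real.sqrt_le_sqrt ?_
        have h := Real.add_one_le_exp (-x)
        have hx0 : 0 < Real.exp x := Real.exp_pos x
        calc Real.exp x * (1 - x) ≤ Real.exp x * Real.exp (-x) :=
              mul_le_mul_of_nonneg_left (by linarith) hx0.le
          _ = 1 := by rw [← Real.exp_add, add_neg_cancel, Real.exp_zero]
    _ = 1 := Real.sqrt_one

/-- **One mode**: `b/√(a(2b − a)) ≥ e^{½(1 − a/b)²}` for `0 < a < 2b`, `0 < b`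
(`a(2b − a)/b² = 1 − (1 − a/b)²`). -/
theorem gaussMode_invESS_ge_exp {a b : ℝ} (ha : 0 < a) (hb : 0 < b) (hab : a < 2 * b) :
    Real.exp ((1 - a / b) ^ 2 / 2) ≤ b / Real.sqrt (a * (2 * b - a)) := by
  have hx : (1 - a / b) ^ 2 < 1 := by
    have h1 : -1 < 1 - a / b := by
      have : a / b < 2 := (div_lt_iff₀ hb).mpr (by linarith)
      linarith
    have h2 : 1 - a / b < 1 := by
      have : 0 < a / b := div_pos ha hb
      linarith
    nlinarith
  have h := exp_half_le_one_div_sqrt hx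
  have e : b / Real.sqrt (a * (2 * b - a)) = 1 / Real.sqrt (1 - (1 - a / b) ^ 2) := by
    have e1 : a * (2 * b - a) = b ^ 2 * (1 - (1 - a / b) ^ 2) := by
      field_simp
      ring
    rw [e1, Real.sqrt_mul (sq_nonneg b), Real.sqrt_sq hb.le]
    field_simp
  rw [e]
  exact h

variable {ι : Type*} [Fintype ι]

/-- **Product**: `Π_k b_k/√(a_k(2b_k − a_k)) ≥ exp(½ Σ_k (1 − a_k/b_k)²)`. -/
theorem prod_invESS_ge_exp (a b : ι → NNReal) (ha : ∀ i, a i ≠ 0) (hb : ∀ i, b i ≠ 0)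
    (hab : ∀ i, ((a i : NNReal) : ℝ) < 2 * b i) :
    Real.exp ((1 / 2) * ∑ i, (1 - (a i : ℝ) / b i) ^ 2)
      ≤ ∏ i, ((b i : ℝ) / Real.sqrt (a i * (2 * b i - a i))) := by
  have ha' : ∀ i, (0 : ℝ) < a i := fun i => by exact_mod_cast pos_iff_ne_zero.mpr (ha i)
  have hb' : ∀ i, (0 : ℝ) < b i := fun i => by exact_mod_cast pos_iff_ne_zero.mpr (hb i)
  rw [Finset.mul_sum, Real.exp_sum]
  refine Finset.prod_le_prod (fun i _ => (Real.exp_pos _).le) fun i _ => ?_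
  have e : 1 / 2 * (1 - (a i : ℝ) / b i) ^ 2 = (1 - (a i : ℝ) / b i) ^ 2 / 2 := by ring
  rw [e]
  exact gaussMode_invESS_ge_exp (ha' i) (hb' i) (hab i)

/-! ## §2 The floor for every sign observable -/

/-- **`τ_int(g) ≥ Π_k b_k/√(a_k(2b_k − a_k)) − ½ = 1/κ − ½`** for every sign observable `g`
(`g² = 1`, `∫ g p = 0`) of the exact independence sampler with product Gaussian target and model. -/
theorem freeFieldFlow_sign_tauInt_ge_prod (a b : ι → NNReal) (ha : ∀ i, a i ≠ 0) (hb : ∀ i, b i ≠ 0)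
    (hab : ∀ i, ((a i : NNReal) : ℝ) < 2 * b i) {g : (ι → ℝ) → ℝ} (hgm : Measurable g)
    (hg1 : ∀ x, g x ^ 2 = 1) (hg0 : ∫ x : ι → ℝ, g x * ∏ i, gaussianPDFReal 0 (a i) (x i) = 0) :
    (∏ i, ((b i : ℝ) / Real.sqrt (a i * (2 * b i - a i)))) - 1 / 2
      ≤ tauInt (fun k => (∫ x : ι → ℝ, g x
        * ((imhOp volume (fun x : ι → ℝ => ∏ i, gaussianPDFReal 0 (a i) (x i))
            (fun x : ι → ℝ => ∏ i, gaussianPDFReal 0 (b i) (x i)))^[k] g) x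
        * ∏ i, gaussianPDFReal 0 (a i) (x i))
        / ∫ x : ι → ℝ, g x ^ 2 * ∏ i, gaussianPDFReal 0 (a i) (x i)) := by
  obtain ⟨hp0, hpm, hpi, hp1⟩ := gaussProd_facts a ha
  obtain ⟨hq0, hqm, hqi, hq1⟩ := gaussProd_facts b hb
  have hW : ∫ x : ι → ℝ, (∏ i, gaussianPDFReal 0 (a i) (x i)) / (∏ i, gaussianPDFReal 0 (b i) (x i))
      * ∏ i, gaussianPDFReal 0 (a i) (x i) = ∏ i, ((b i : ℝ) / Real.sqrt (a i * (2 * b i - a i))) :=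
    gaussProd_weightMoment a b ha hb hab
  have hWpos : 0 < ∏ i, ((b i : ℝ) / Real.sqrt (a i * (2 * b i - a i))) := by
    refine Finset.prod_pos fun i _ => ?_
    have ha' : (0 : ℝ) < a i := by exact_mod_cast pos_iff_ne_zero.mpr (ha i)
    have hb' : (0 : ℝ) < b i := by exact_mod_cast pos_iff_ne_zero.mpr (hb i)
    have : 0 < 2 * (b i : ℝ) - a i := by linarith [hab i]
    positivity
  have hW₂ : Integrable (fun x : ι → ℝ => (∏ i, gaussianPDFReal 0 (a i) (x i))
      / (∏ i, gaussianPDFReal 0 (b i) (x i)) * ∏ i, gaussianPDFReal 0 (a i) (x i)) := by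
    by_contra h
    rw [integral_undef h] at hW
    exact hWpos.ne' hW.symm |>.elim
  have h := (imhOp_sign_tauInt_sandwich (μ := volume) hp0 hpm hpi hq0 hqm hqi hq1 hW₂ hgm hg1 hg0).1
  rw [hW, hp1, one_pow, div_one] at h
  exact h

/-- **THE VOLUME FLOOR**: `τ_int(g) ≥ exp(½ Σ_k (1 − a_k/b_k)²) − ½` for every sign observable. -/
theorem freeFieldFlow_sign_tauInt_ge_exp (a b : ι → NNReal) (ha : ∀ i, a i ≠ 0) (hb : ∀ i, b i ≠ 0)
    (hab : ∀ i, ((a i : NNReal) : ℝ) < 2 * b i) {g : (ι → ℝ) → ℝ} (hgm : Measurable g)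
    (hg1 : ∀ x, g x ^ 2 = 1) (hg0 : ∫ x : ι → ℝ, g x * ∏ i, gaussianPDFReal 0 (a i) (x i) = 0) :
    Real.exp ((1 / 2) * ∑ i, (1 - (a i : ℝ) / b i) ^ 2) - 1 / 2
      ≤ tauInt (fun k => (∫ x : ι → ℝ, g x
        * ((imhOp volume (fun x : ι → ℝ => ∏ i, gaussianPDFReal 0 (a i) (x i))
            (fun x : ι → ℝ => ∏ i, gaussianPDFReal 0 (b i) (x i)))^[k] g) x
        * ∏ i, gaussianPDFReal 0 (a i) (x i))
        / ∫ x : ι → ℝ, g x ^ 2 * ∏ i, gaussianPDFReal 0 (a i) (x i)) :=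
  le_trans (sub_le_sub_right (prod_invESS_ge_exp a b ha hb hab) _)
    (freeFieldFlow_sign_tauInt_ge_prod a b ha hb hab hgm hg1 hg0)

/-! ## §3 An exhibited sign observable: the sign of one mode -/

/-- **The half-line sign is centred under a centred Gaussian**: `∫ sgn₊(t) N(0,v)(t) dt = 0`,
`sgn₊(t) = 1` for `t ≥ 0`, `−1` else (reflection `t ↦ −t`; the two signs differ from each other's
negatives only at `t = 0`, a null set). -/
theorem integral_halfLineSign_mul_gaussian (v : NNReal) :
    ∫ t : ℝ, (if 0 ≤ t then (1 : ℝ) else -1) * gaussianPDFReal 0 v t = 0 := by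
  haveI := isNegInvariant_volume_real
  set h : ℝ → ℝ := fun t => (if 0 ≤ t then (1 : ℝ) else -1) * gaussianPDFReal 0 v t with hh
  have hrefl := integral_neg_eq_self h volume
  -- `h(−t) = −h(t)` for `t ≠ 0`
  have hae : (fun t => h (-t)) =ᵐ[volume] fun t => -h t := by
    have hnull : (volume : Measure ℝ) {0} = 0 := Real.volume_singleton
    filter_upwards [measure_eq_zero_iff_ae_notMem.mp hnull] with t ht
    have ht0 : t ≠ 0 := fun e => ht (by rw [e]; exact Set.mem_singleton 0)
    simp only [hh, gaussianPDFReal_def, sub_zero, neg_pow_two, neg_nonneg]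
    rcases lt_or_gt_of_ne ht0 with hlt | hgt
    · rw [if_pos hlt.le, if_neg (not_le.mpr hlt)]
      ring
    · rw [if_neg (not_le.mpr hgt), if_pos hgt.le]
      ring
  rw [integral_congr_ae hae, integral_neg] at hrefl
  have : ∫ t, h t = 0 := by linarith
  simpa [hh] using this

/-- **The sign of one mode is a sign observable of the product target**: for every `k₀`,
`∫ sgn₊(x_{k₀}) Π_k N(0,a_k)(x_k) dx = 0` (Fubini: the `k₀` factor integrates to zero). -/
theorem integral_coordSign_mul_gaussProd (a : ι → NNReal) (k₀ : ι) :
    ∫ x : ι → ℝ, (if 0 ≤ x k₀ then (1 : ℝ) else -1) * ∏ i, gaussianPDFReal 0 (a i) (x i) = 0 := by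
  classical
  set F : ι → ℝ → ℝ := Function.update (fun i t => gaussianPDFReal 0 (a i) t) k₀
    (fun t => (if 0 ≤ t then (1 : ℝ) else -1) * gaussianPDFReal 0 (a k₀) t) with hF
  have e : ∀ x : ι → ℝ, (if 0 ≤ x k₀ then (1 : ℝ) else -1) * ∏ i, gaussianPDFReal 0 (a i) (x i)
      = ∏ i, F i (x i) := by
    intro x
    rw [← Finset.mul_prod_erase Finset.univ (fun i => gaussianPDFReal 0 (a i) (x i))
      (Finset.mem_univ k₀),
      ← Finset.mul_prod_erase Finset.univ (fun i => F i (x i)) (Finset.mem_univ k₀)]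
    have h0 : F k₀ (x k₀) = (if 0 ≤ x k₀ then (1 : ℝ) else -1) * gaussianPDFReal 0 (a k₀) (x k₀) := by
      rw [hF, Function.update_self]
    have h1 : ∏ i ∈ Finset.univ.erase k₀, F i (x i)
        = ∏ i ∈ Finset.univ.erase k₀, gaussianPDFReal 0 (a i) (x i) := by
      refine Finset.prod_congr rfl fun i hi => ?_
      rw [hF, Function.update_of_ne (Finset.ne_of_mem_erase hi)]
    rw [h0, h1]
    ring
  simp_rw [e]
  rw [integral_fintype_prod_volume_eq_prod (f := F)]
  refine Finset.prod_eq_zero (Finset.mem_univ k₀) ?_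
  rw [hF, Function.update_self]
  exact integral_halfLineSign_mul_gaussian (a k₀)

/-- **THE VOLUME FLOOR WITH THE OBSERVABLE EXHIBITED**: for every mode `k₀`, the sign of `x_{k₀}` obeys
`τ_int ≥ exp(½ Σ_k (1 − a_k/b_k)²) − ½` along the exact flow sampler of the free field with a product
Gaussian model (`a_k < 2b_k`; for `a_k ≥ 2b_k` some mode's sign super-levels are not even summable,
`GaussModeTauIntDichotomy`). -/
theorem freeFieldFlow_coordSign_tauInt_ge_exp (a b : ι → NNReal) (ha : ∀ i, a i ≠ 0)
    (hb : ∀ i, b i ≠ 0) (hab : ∀ i, ((a i : NNReal) : ℝ) < 2 * b i) (k₀ : ι) :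
    Real.exp ((1 / 2) * ∑ i, (1 - (a i : ℝ) / b i) ^ 2) - 1 / 2
      ≤ tauInt (fun k => (∫ x : ι → ℝ, (if 0 ≤ x k₀ then (1 : ℝ) else -1)
        * ((imhOp volume (fun x : ι → ℝ => ∏ i, gaussianPDFReal 0 (a i) (x i))
            (fun x : ι → ℝ => ∏ i, gaussianPDFReal 0 (b i) (x i)))^[k]
              (fun x => if 0 ≤ x k₀ then (1 : ℝ) else -1)) x
        * ∏ i, gaussianPDFReal 0 (a i) (x i))
        / ∫ x : ι → ℝ, (if 0 ≤ x k₀ then (1 : ℝ) else -1) ^ 2 * ∏ i, gaussianPDFReal 0 (a i) (x i)) := by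
  have hgm : Measurable (fun x : ι → ℝ => if 0 ≤ x k₀ then (1 : ℝ) else -1) :=
    Measurable.ite (measurableSet_le measurable_const (measurable_pi_apply k₀))
      measurable_const measurable_const
  have hg1 : ∀ x : ι → ℝ, (if 0 ≤ x k₀ then (1 : ℝ) else -1) ^ 2 = 1 := fun x => by
    split_ifs <;> norm_num
  exact freeFieldFlow_sign_tauInt_ge_exp a b ha hb hab hgm hg1 (integral_coordSign_mul_gaussProd a k₀)

end Summit.Ventures.LatticeQCDFlow.Exactness
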